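import Mathlib
import Summits.MatrixMultiplication.MatrixMultiplication.Theorems.FourierTwoFamiliesModPPrimeCyclicPowerGainThetaOrbit

/-!
# The fractional clique-cover bound for theta-body kernels (abstract form)

Crux `stmt-MatrixMultiplication-14309` (`FourierTwoFamiliesModP.PrimeCyclicPowerGain`), line
`clique-coclique-direct-sum-clique`, milestone 3 of the bet `stub_thetaBound`; closes the registered milestone stub
`stub_thetaCliqueCover`.

Setting: a finite type `V`, a kernel `B : V → V → ℝ` that is symmetric, positive semidefinite as a real quadratic
form (raw `Finset.univ` double-sum hypothesis) and entrywise nonnegative; a finite family of "cliques" `C i ⊆ V`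
(`B` vanishes on two DISTINCT vertices of a common clique) with weights `y i ≥ 0`, covering every vertex of the
diagonal support `{v : B v v ≠ 0}` with multiplicity `Y v := ∑ i, [v ∈ C i] · y i ∈ [1, μ]`.  Then
`∑ v, ∑ w, B v w ≤ μ · (∑ i, y i) · ∑ v, B v v` (`stub_thetaCliqueCover`) — the LP-duality-free,
square-root-free form of the classical bound `ϑ ≤` fractional clique cover number.

Proof.  (1) A nonzero entry `B v w` has nonzero diagonal partners `B v v`, `B w w`
(`Orbit.entry_eq_zero_of_diag_eq_zero`), so `Y v, Y w ≥ 1` and `B v w ≤ Y v · B v w · Y w`; summing,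
`Σ B ≤ Yᵀ B Y`.  (2) Convexity of the PSD form (`quad_combination_le`, Jensen without division): with
`Y = Σ_i y_i 1_{C i}`, `Yᵀ B Y = Σ_{i,j} y_i y_j 1_iᵀ B 1_j ≤ Σ_{i,j} y_i y_j (1_iᵀ B 1_i + 1_jᵀ B 1_j) / 2
= (Σ y) · Σ_i y_i 1_iᵀ B 1_i` (polarisation `2 xᵀBz ≤ xᵀBx + zᵀBz`, `two_mul_cross_le_add`).
(3) The clique hypothesis kills the off-diagonal part of `1_iᵀ B 1_i`, leaving `Σ_{v ∈ C i} B v v`; hence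
`Σ_i y_i 1_iᵀ B 1_i = Σ_v B v v · Y v ≤ μ · tr B` (diagonal entries are `≥ 0`, `Kernel.diag_nonneg_of_psd`).
-/

namespace Summit.MatrixMultiplication.MatrixMultiplication.Theorems.PrimeCyclicPowerGainTheta.CliqueCover

open scoped BigOperators
open Summit.MatrixMultiplication.MatrixMultiplication.Theorems.PrimeCyclicPowerGainTheta

variable {ι V : Type*} [Fintype ι] [Fintype V]

/-- Linearity of the pairing `∑ v, ∑ w, x v * B v w * z w` in the LEFT slot, for a finite linear combination
`x = Σ_i a_i • x_i`. -/
theorem sum_left (B : V → V → ℝ) (a : ι → ℝ) (x : ι → V → ℝ) (z : V → ℝ) :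
    ∑ v, ∑ w, (∑ i, a i * x i v) * B v w * z w = ∑ i, a i * ∑ v, ∑ w, x i v * B v w * z w := by
  calc ∑ v, ∑ w, (∑ i, a i * x i v) * B v w * z w
      = ∑ v, ∑ w, ∑ i, a i * (x i v * B v w * z w) := by
        refine Finset.sum_congr rfl fun v _ => Finset.sum_congr rfl fun w _ => ?_
        rw [Finset.sum_mul, Finset.sum_mul]
        exact Finset.sum_congr rfl fun i _ => by ring
    _ = ∑ v, ∑ i, ∑ w, a i * (x i v * B v w * z w) :=
        Finset.sum_congr rfl fun v _ => Finset.sum_comm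
    _ = ∑ i, ∑ v, ∑ w, a i * (x i v * B v w * z w) := Finset.sum_comm
    _ = ∑ i, a i * ∑ v, ∑ w, x i v * B v w * z w := by
        refine Finset.sum_congr rfl fun i _ => ?_
        rw [Finset.mul_sum]
        exact Finset.sum_congr rfl fun v _ => by rw [Finset.mul_sum]

/-- Linearity of the pairing `∑ v, ∑ w, z v * B v w * x w` in the RIGHT slot, for a finite linear combination
`x = Σ_j a_j • x_j`. -/
theorem sum_right (B : V → V → ℝ) (z : V → ℝ) (a : ι → ℝ) (x : ι → V → ℝ) :
    ∑ v, ∑ w, z v * B v w * (∑ j, a j * x j w) = ∑ j, a j * ∑ v, ∑ w, z v * B v w * x j w := by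
  calc ∑ v, ∑ w, z v * B v w * (∑ j, a j * x j w)
      = ∑ v, ∑ w, ∑ j, a j * (z v * B v w * x j w) := by
        refine Finset.sum_congr rfl fun v _ => Finset.sum_congr rfl fun w _ => ?_
        rw [Finset.mul_sum]
        exact Finset.sum_congr rfl fun j _ => by ring
    _ = ∑ v, ∑ j, ∑ w, a j * (z v * B v w * x j w) :=
        Finset.sum_congr rfl fun v _ => Finset.sum_comm
    _ = ∑ j, ∑ v, ∑ w, a j * (z v * B v w * x j w) := Finset.sum_comm
    _ = ∑ j, a j * ∑ v, ∑ w, z v * B v w * x j w := by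
        refine Finset.sum_congr rfl fun j _ => ?_
        rw [Finset.mul_sum]
        exact Finset.sum_congr rfl fun v _ => by rw [Finset.mul_sum]

/-- Bilinear expansion of the quadratic form at a finite linear combination:
`(Σ_i a_i x_i)ᵀ B (Σ_j a_j x_j) = Σ_{i,j} a_i a_j · x_iᵀ B x_j`. -/
theorem quad_expand (B : V → V → ℝ) (a : ι → ℝ) (x : ι → V → ℝ) :
    ∑ v, ∑ w, (∑ i, a i * x i v) * B v w * (∑ j, a j * x j w) =
      ∑ i, ∑ j, a i * a j * ∑ v, ∑ w, x i v * B v w * x j w := by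
  rw [sum_left B a x (fun w => ∑ j, a j * x j w)]
  refine Finset.sum_congr rfl fun i _ => ?_
  rw [sum_right B (x i) a x, Finset.mul_sum]
  exact Finset.sum_congr rfl fun j _ => by ring

/-- Polarisation for a symmetric PSD kernel: `2 · xᵀ B z ≤ xᵀ B x + zᵀ B z` (PSD at `x − z`). -/
theorem two_mul_cross_le_add (B : V → V → ℝ) (hsymm : ∀ v w, B v w = B w v)
    (hpsd : ∀ x : V → ℝ, 0 ≤ ∑ v, ∑ w, x v * B v w * x w) (x z : V → ℝ) :
    2 * ∑ v, ∑ w, x v * B v w * z w ≤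
      ∑ v, ∑ w, x v * B v w * x w + ∑ v, ∑ w, z v * B v w * z w := by
  have h := Kernel.neg_add_le_two_mul_cross_of_psd B hsymm hpsd x (fun v => -z v)
  have e1 : ∑ v, ∑ w, (-z v) * B v w * (-z w) = ∑ v, ∑ w, z v * B v w * z w :=
    Finset.sum_congr rfl fun v _ => Finset.sum_congr rfl fun w _ => by ring
  have e2 : ∑ v, ∑ w, x v * B v w * (-z w) = -∑ v, ∑ w, x v * B v w * z w := by
    rw [← Finset.sum_neg_distrib]
    refine Finset.sum_congr rfl fun v _ => ?_
    rw [← Finset.sum_neg_distrib]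
    exact Finset.sum_congr rfl fun w _ => by ring
  rw [e1, e2] at h
  linarith

/-- **Convexity of a PSD quadratic form** (Jensen, division-free): for weights `a i ≥ 0`,
`(Σ_i a_i x_i)ᵀ B (Σ_i a_i x_i) ≤ (Σ_i a_i) · Σ_i a_i · x_iᵀ B x_i`. -/
theorem quad_combination_le (B : V → V → ℝ) (hsymm : ∀ v w, B v w = B w v)
    (hpsd : ∀ x : V → ℝ, 0 ≤ ∑ v, ∑ w, x v * B v w * x w) (a : ι → ℝ) (ha : ∀ i, 0 ≤ a i)
    (x : ι → V → ℝ) :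
    ∑ v, ∑ w, (∑ i, a i * x i v) * B v w * (∑ j, a j * x j w) ≤
      (∑ i, a i) * ∑ i, a i * ∑ v, ∑ w, x i v * B v w * x i w := by
  rw [quad_expand]
  set q : ι → ι → ℝ := fun i j => ∑ v, ∑ w, x i v * B v w * x j w with hq
  change ∑ i, ∑ j, a i * a j * q i j ≤ (∑ i, a i) * ∑ i, a i * q i i
  have h3 : ∀ i j, 2 * q i j ≤ q i i + q j j := fun i j =>
    two_mul_cross_le_add B hsymm hpsd (x i) (x j)
  have e2 : ∑ i, ∑ j, a i * a j * q i i = (∑ i, a i) * ∑ j, a j * q j j := by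
    rw [Finset.sum_comm, Finset.sum_mul_sum]
    exact Finset.sum_congr rfl fun j _ => Finset.sum_congr rfl fun i _ => by ring
  have e3 : ∑ i, ∑ j, a i * a j * q j j = (∑ i, a i) * ∑ j, a j * q j j := by
    rw [Finset.sum_mul_sum]
    exact Finset.sum_congr rfl fun i _ => Finset.sum_congr rfl fun j _ => by ring
  calc ∑ i, ∑ j, a i * a j * q i j
      ≤ ∑ i, ∑ j, a i * a j * ((q i i + q j j) / 2) :=
        Finset.sum_le_sum fun i _ => Finset.sum_le_sum fun j _ =>
          mul_le_mul_of_nonneg_left (by linarith [h3 i j]) (mul_nonneg (ha i) (ha j))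
    _ = (∑ i, ∑ j, a i * a j * q i i) / 2 + (∑ i, ∑ j, a i * a j * q j j) / 2 := by
        rw [Finset.sum_div, Finset.sum_div, ← Finset.sum_add_distrib]
        refine Finset.sum_congr rfl fun i _ => ?_
        rw [Finset.sum_div, Finset.sum_div, ← Finset.sum_add_distrib]
        exact Finset.sum_congr rfl fun j _ => by ring
    _ = (∑ i, a i) * ∑ i, a i * q i i := by rw [e2, e3]; ring

/-- **The fractional clique-cover bound** (named-hypothesis form of `stub_thetaCliqueCover`).  `B` symmetric,
PSD, entrywise `≥ 0`; cliques `C i` with weights `y i ≥ 0` on which `B` has no off-diagonal entries, covering the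
diagonal support with multiplicity in `[1, μ]`.  Then `∑ v, ∑ w, B v w ≤ μ · (∑ i, y i) · ∑ v, B v v`. -/
theorem value_le_of_cliqueCover [DecidableEq V] (B : V → V → ℝ) (C : ι → Finset V) (y : ι → ℝ) (μ : ℝ)
    (hsymm : ∀ v w, B v w = B w v)
    (hpsd : ∀ x : V → ℝ, 0 ≤ ∑ v, ∑ w, x v * B v w * x w)
    (hnn : ∀ v w, 0 ≤ B v w) (hy : ∀ i, 0 ≤ y i)
    (hclique : ∀ i, ∀ v ∈ C i, ∀ w ∈ C i, v ≠ w → B v w = 0)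
    (hcov : ∀ v, B v v ≠ 0 → 1 ≤ ∑ i, if v ∈ C i then y i else 0)
    (hmult : ∀ v, B v v ≠ 0 → (∑ i, if v ∈ C i then y i else 0) ≤ μ) :
    ∑ v, ∑ w, B v w ≤ μ * (∑ i, y i) * ∑ v, B v v := by
  -- indicator vectors of the cliques; the cover multiplicity is `Y v = ∑ i, y i * e i v`
  set e : ι → V → ℝ := fun i v => if v ∈ C i then 1 else 0 with he
  have hYe : ∀ v, (∑ i, if v ∈ C i then y i else 0) = ∑ i, y i * e i v := by
    intro v
    refine Finset.sum_congr rfl fun i _ => ?_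
    simp only [he]
    split_ifs <;> simp
  -- Step 1: `Σ B ≤ Yᵀ B Y`, entrywise
  have h1 : ∑ v, ∑ w, B v w ≤ ∑ v, ∑ w, (∑ i, y i * e i v) * B v w * (∑ j, y j * e j w) := by
    refine Finset.sum_le_sum fun v _ => Finset.sum_le_sum fun w _ => ?_
    by_cases hvw : B v w = 0
    · rw [hvw]; simp
    · have hvv : B v v ≠ 0 := fun h =>
        hvw (Orbit.entry_eq_zero_of_diag_eq_zero B hsymm hpsd v w h)
      have hww : B w w ≠ 0 := fun h =>
        hvw ((hsymm v w).trans (Orbit.entry_eq_zero_of_diag_eq_zero B hsymm hpsd w v h))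
      have h1v : 1 ≤ ∑ i, y i * e i v := by rw [← hYe v]; exact hcov v hvv
      have h1w : 1 ≤ ∑ j, y j * e j w := by rw [← hYe w]; exact hcov w hww
      have hb := hnn v w
      nlinarith [mul_nonneg hb (mul_nonneg (sub_nonneg.2 h1v) (sub_nonneg.2 h1w)),
        mul_nonneg hb (sub_nonneg.2 h1v), mul_nonneg hb (sub_nonneg.2 h1w)]
  -- Step 2: convexity of the PSD form
  have h2 := quad_combination_le B hsymm hpsd y hy e
  -- Step 3: the clique hypothesis leaves only the diagonal of `1_iᵀ B 1_i`
  have h4 : ∀ i, ∑ v, ∑ w, e i v * B v w * e i w = ∑ v, e i v * B v v := by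
    intro i
    refine Finset.sum_congr rfl fun v _ => ?_
    by_cases hv : v ∈ C i
    · rw [Finset.sum_eq_single v]
      · simp [he, hv]
      · intro w _ hwv
        by_cases hw : w ∈ C i
        · rw [hclique i v hv w hw (Ne.symm hwv)]; ring
        · simp [he, hw]
      · intro h; exact absurd (Finset.mem_univ v) h
    · simp [he, hv]
  have h6 : ∑ i, y i * ∑ v, ∑ w, e i v * B v w * e i w = ∑ v, B v v * ∑ i, y i * e i v := by
    calc ∑ i, y i * ∑ v, ∑ w, e i v * B v w * e i w
        = ∑ i, ∑ v, y i * (e i v * B v v) := by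
          refine Finset.sum_congr rfl fun i _ => ?_
          rw [h4 i, Finset.mul_sum]
      _ = ∑ v, ∑ i, y i * (e i v * B v v) := Finset.sum_comm
      _ = ∑ v, B v v * ∑ i, y i * e i v := by
          refine Finset.sum_congr rfl fun v _ => ?_
          rw [Finset.mul_sum]
          exact Finset.sum_congr rfl fun i _ => by ring
  -- Step 4: multiplicity `≤ μ` on the diagonal support
  have h7 : ∑ v, B v v * ∑ i, y i * e i v ≤ μ * ∑ v, B v v := by
    rw [Finset.mul_sum]
    refine Finset.sum_le_sum fun v _ => ?_
    by_cases hv : B v v = 0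
    · rw [hv]; simp
    · have hpos : 0 ≤ B v v := Kernel.diag_nonneg_of_psd B hpsd v
      have hle : ∑ i, y i * e i v ≤ μ := by rw [← hYe v]; exact hmult v hv
      calc B v v * ∑ i, y i * e i v ≤ B v v * μ := mul_le_mul_of_nonneg_left hle hpos
        _ = μ * B v v := mul_comm _ _
  have hS : 0 ≤ ∑ i, y i := Finset.sum_nonneg fun i _ => hy i
  calc ∑ v, ∑ w, B v w ≤ ∑ v, ∑ w, (∑ i, y i * e i v) * B v w * (∑ j, y j * e j w) := h1
    _ ≤ (∑ i, y i) * ∑ i, y i * ∑ v, ∑ w, e i v * B v w * e i w := h2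
    _ = (∑ i, y i) * ∑ v, B v v * ∑ i, y i * e i v := by rw [h6]
    _ ≤ (∑ i, y i) * (μ * ∑ v, B v v) := mul_le_mul_of_nonneg_left h7 hS
    _ = μ * (∑ i, y i) * ∑ v, B v v := by ring

/-- **Registered milestone stub `stub_thetaCliqueCover`** (crux stmt-MatrixMultiplication-14309, line
clique-coclique-direct-sum-clique; milestone 3 of the bet `stub_thetaBound`): the fractional clique-cover bound
without LP duality or square roots.  `B` symmetric, PSD, entrywise `≥ 0` on a finite `V`; cliques `C i` with weights
`y i ≥ 0` such that `B` vanishes on distinct vertices of a common clique, every vertex of the diagonal support is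
covered with multiplicity `≥ 1`, and no such vertex with multiplicity `> μ`.
Then `Σ B ≤ μ · (Σ y) · tr B`. -/
theorem stub_thetaCliqueCover :
    ∀ (V : Type) [Fintype V] [DecidableEq V] (ι : Type) [Fintype ι]
      (B : V → V → ℝ) (C : ι → Finset V) (y : ι → ℝ) (μ : ℝ),
      (∀ v w, B v w = B w v) →
      (∀ x : V → ℝ, 0 ≤ ∑ v, ∑ w, x v * B v w * x w) →
      (∀ v w, 0 ≤ B v w) →
      (∀ i, 0 ≤ y i) →
      (∀ i, ∀ v ∈ C i, ∀ w ∈ C i, v ≠ w → B v w = 0) →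
      (∀ v, B v v ≠ 0 → 1 ≤ ∑ i, if v ∈ C i then y i else 0) →
      (∀ v, B v v ≠ 0 → (∑ i, if v ∈ C i then y i else 0) ≤ μ) →
      ∑ v, ∑ w, B v w ≤ μ * (∑ i, y i) * ∑ v, B v v :=
  fun _ _ _ _ _ B C y μ hsymm hpsd hnn hy hclique hcov hmult =>
    value_le_of_cliqueCover B C y μ hsymm hpsd hnn hy hclique hcov hmult

end Summit.MatrixMultiplication.MatrixMultiplication.Theorems.PrimeCyclicPowerGainTheta.CliqueCover
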